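import Summits.HodgeConjecture.HodgeConjecture.Theorems.F0P6aRGDAssemblyDefsLetters   -- ★ previous part of the same Lines workfile `F0_P6a_RGDAssembly` (size-lint split ×3)
import HarnessLib

/-!
# `F0P6aRGDAssemblyDefsInputs` — ★ RE-HOME of `Lines/F0_P6a_RGDAssembly.lean`, PART 2 of 3 (size-lint split; cut at a declaration boundary).

See PART 1 `Theorems/F0P6aRGDAssemblyDefsLetters.lean` for the full re-home header and the original module docstring (verbatim there). Namespaces and sections KEPT
(re-opened below exactly as they stand at the cut, with their `open`∕`variable` lines replayed); code bytes = the workfile՚s, docstrings included; options preamble repeated from PART 1.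
HC_CM is proved only modulo the 7 printed citations (2 remaining: hLiu418 = stmt-HodgeConjecture-24832, h413 = stmt-HodgeConjecture-24833) until rung 0 closes; a re-home is count-neutral. -/

set_option autoImplicit false

noncomputable section

namespace Summit.HodgeConjecture.HodgeConjecture.Cruxes.HLiu418.F0P6aRGDAssembly
set_option linter.dupNamespace false  -- `Summit.HodgeConjecture.HodgeConjecture.…` BY DESIGN (D-0017)
open CategoryTheory CategoryTheory.Limits NumberField IsDedekindDomain MulAction
open scoped Matrix Polynomial Pointwise
open Literature.NumberTheory.GaloisRepresentations
open Literature.NumberTheory.Automorphic Literature.NumberTheory.Automorphic.UnitaryGroup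
open Literature.AlgebraicGeometry.ShimuraVarieties.UnitaryCanonicalModel
open Literature.NumberTheory.Automorphic.Liu2021.AppendixC
open Literature.AlgebraicGeometry.Motives (AlgPoints IntegralModel SchemeOver thickening thickeningGalAction thickeningLift relFrobeniusOver frobSpec)
open Literature.NumberTheory.DiophantineGeometry (geomResidueField specialFibreFunctor)
open Literature.AlgebraicGeometry.RelativeSpec (ActionOver)
open Literature.NumberTheory.EllipticCurves (genericFibre)
open AlgebraicGeometry (QuasiCompact QuasiSeparated LocallyOfFinitePresentation Flat IsSeparated)
open Summit.HodgeConjecture.HodgeConjecture.Cruxes.HLiu418.F0P6aModuliDatumDefs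


/-- **`RGDInputsAt … Kc G 𝓜 w hw h𝓨 θ e` — THE LOCALISED PEL TUPLE WITH ITS LAWS** at MH՚s inner binders (same parameters as `ModuliDatum`): the D1∕D-1 data
`univ act dual pol g N lvl` over `𝓨 = (𝓜.localise w).total` (door (E): the spread of `ε^* 𝓜_Sieg.univ` localised at `w`), with (K) `hg : g = [F:ℚ]` and `relDim`
(⇒ the dock՚s `hgF`), `comm`, ROSATI `rosati`, KOTTWITZ AT `Ω`-POINTS `kottwitzΩ` with signature `m : (F →+* Ω) → ℕ` read through restrictions `τR τ : 𝓞 F →+* R`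
(`R ⊆ Ω` the valuation ring) and THE COUNT `m_count : ∑_{τ ↦ c•w} m τ = 1` ((U1-d) ★ p846847 + (S-H-E′) ★ p846856; = the (S-T) `h1` after ★ p846836
`map_blockIdempotent_one_eq_one_iff`), the arithmetic of `w` (`pChar hpChar fDeg hfDeg charP₀`), and the TWIST DATA `twistIdeal twistNorm` with `twistNorm_spec`
(`(n_γ) = 𝔞_γ𝔞̄_γ`) and (f6) `twistIdeal_coprime`.  A data carrier; NOTHING is asserted by declaring it (inhabited cofinitely by `stub_PEL`).
[cite: Kottwitz1992, §5 pp. 389–391] [cite: RapoportSmithlingZhang2020Diagonal, §4.1 p. 17, Rem. 3.6 (3.14) p. 13] [cite: Shimura1998, §13.1 Thm. 1; §7.5 Prop. 24 (pp. 57–58)] -/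
structure RGDInputsAt (F : Type) [Field F] [NumberField F] [IsCMField F] (ι₁ : F →+* ℂ)
    (Jstar : Matrix (Fin 2) (Fin 2) F)
    (K₀ : C5.OpenCompactSubgroup ↥(finAdelic ↥(maximalRealSubfield F) F (IsCMField.complexConj F) 2 Jstar))
    (S : RecordSystemGS F Jstar ι₁ K₀) (hU7ₛ : S.HeckeTranslateDefinedOver)
    (hJ : (Jstar.map (IsCMField.complexConj F))ᵀ = Jstar) (hJu : IsUnit Jstar)
    (Fi : Type) [Field Fi] [Algebra F Fi] (Kc : C5.SmallLevel K₀) (G : Type) [Group G]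
    (𝓜 : IntegralModel (𝓞 F) F ((thickening F Fi).obj (S.M.obj Kc)))
    (w : HeightOneSpectrum (𝓞 F)) (hw : (IsCMField.complexConj F) • w ≠ w) (h𝓨 : (𝓜.localise w).IsSmoothProper 1)
    (θ : ActionOver (𝓜.localise w).total.hom ((Fi ≃ₐ[F] Fi) × G))
    (e : Fi →ₐ[F] AlgebraicClosure (w.adicCompletion F)) where
  /-- D1: the abelian scheme over the localised model (door (E): spread of `ε^* 𝓜_Sieg.univ`, localised at `w`). -/
  univ : Literature.AlgebraicGeometry.AbelianSchemes.AbelianSchemeOver (𝓜.localise w).total.left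
  /-- D1: the `𝒪_F`-action. -/
  act : Literature.AlgebraicGeometry.AbelianSchemes.AbelianSchemeOver.RingAction (𝓞 F) univ
  /-- D1: the dual pair. -/
  dual : univ.DualPair
  /-- D1: the polarisation. -/
  pol : univ.Polarization dual
  /-- D-1: relative dimension. -/
  g : ℕ
  /-- D-1: full level. -/
  N : ℕ
  /-- D-1: the level structure over the whole localised model. -/
  lvl : univ.LevelStructure g N
  /-- (K) `g = [F:ℚ]`. -/
  hg : g = Module.finrank ℚ F
  /-- (K) `univ` is of relative dimension `g` (⇒ the dock՚s `hgF`). -/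
  relDim : univ.IsOfRelDim g
  /-- (K) the group law of `univ` is commutative (★ `AbelianSchemeOverCommOfReduced` over the reduced `𝓨`; a field so the dock՚s `[IsCommMonObj]` binder is met). -/
  comm : IsCommMonObj univ.X
  /-- (S6-R) ROSATI: `ι(b̄) ≫ λ = λ ≫ ι(b)^∨`. -/
  rosati : ∀ (b b' : 𝓞 F), (b' : F) = (IsCMField.complexConj F) (b : F) →
    haveI := act.isMonHom b
    act.i b' ≫ pol.lam = pol.lam ≫ Literature.AlgebraicGeometry.AbelianSchemes.AbelianSchemeOver.DualPair.dualIsogenyOver (act.i b) dual dual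
  /-- (K-Ω) the Kottwitz signature on the `p`-adic embeddings `F →+* Ω = F̄_w` (door (E): `mOf ι₁ Φ(w)` read through `ι : Ω →+* ℂ` extending `ι₁`). -/
  m : (F →+* AlgebraicClosure (w.adicCompletion F)) → ℕ
  /-- (K-Ω) KOTTWITZ AT EVERY `Ω`-POINT OF THE THICKENED GENERIC FIBRE `Y` (every sheet; ED. 2; ★ p846836 `hK` currency with `b` for `a 1`), packaged as
  `KottwitzΩ` (cand v3). -/
  kottwitzΩ : KottwitzΩ S Kc 𝓜 w univ act m
  /-- (K-Ω) the restrictions `τ|_{𝒪_F} : 𝓞 F →+* R` to the valuation ring `R ⊆ Ω` (algebraic integers are `w̄`-integral). -/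
  τR : (F →+* AlgebraicClosure (w.adicCompletion F)) → (𝓞 F →+* ↥(closureValuationSubring (w.adicCompletion F)))
  /-- (K-Ω) `τR τ` IS the restriction of `τ`. -/
  τR_spec : ∀ (τ : F →+* AlgebraicClosure (w.adicCompletion F)) (x : 𝓞 F),
    ((τR τ x : ↥(closureValuationSubring (w.adicCompletion F))) : AlgebraicClosure (w.adicCompletion F)) = τ (x : F)
  /-- (K-Ω) THE COUNT «the `c•w`-block of `Lie` is a line»: `∑_{τ inducing c•w} m τ = 1` ((U1-d) ★ p846847; [RSZ2020] (4.6)). -/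
  m_count : ∑ τ ∈ (Finset.univ.filter fun τ : F →+* AlgebraicClosure (w.adicCompletion F) =>
      RingHom.ker ((IsLocalRing.residue ↥(closureValuationSubring (w.adicCompletion F))).comp (τR τ)) =
        (((IsCMField.complexConj F) • w).asIdeal : Ideal (𝓞 F))), m τ = 1
  /-- (ii-4) the rational prime under `w`. -/
  pChar : ℕ
  /-- (ii-4) `p` prime, `p ∈ 𝔭_w`. -/
  hpChar : Nat.Prime pChar ∧ (pChar : 𝓞 F) ∈ w.asIdeal
  /-- (R-unr) **`p` IS UNRAMIFIED AT `w` TO FIRST ORDER: `𝔭_w² ∤ (p)`** (ED. 5 law field; LEAD heir (g3) «M-71» (1) = (H1); [Liu2021] §D.4 p. 134 «p is unramified in E»).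
  For `e(w|p) ≥ 2` the `e_p^λ`-pairing between the `w`- and `c•w`-layers of `A[p]` is identically trivial, so the D-side (L2 `stub_SPEC`: [WQ] ∕ (ρ2) ∕ Road S) cannot pin the
  `w`-layer kernel from (P-1) alone; the interface excludes the regime instead of importing the refined duality `A[𝔭_w]^D ≅ A[𝔭_{c•w}]`.  Producer (P-line ED. 3):
  `S_M ⊇ {w | ∃ p prime, 𝔭_w² ∣ (p)}` (finite, ★ `Literature.NumberTheory.NumberFields.finite_setOf_sq_dvd_span_natCast`) and `fun h => hwD ⟨pChar, hpChar.1, h⟩` off it.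
  Consumers: `I.hunr` (the `c•w` twin is a lemma: `c` fixes `(p)`).  `RGDInputsAt` only — no `ModuliDatum` twin, no socket binder (LAref-D 06:12:12Z (3); P6c (g5) (H1)).
  [cite: Liu2021, §D.4 (p. 134)] [cite: NeukirchANT1999, Ch. III §2 Thm. (2.6) p. 199] -/
  hunr : ¬ (w.asIdeal ^ 2 ∣ Ideal.span {((pChar : ℕ) : 𝓞 F)})
  /-- (R-1) the residue degree `f_w`. -/
  fDeg : ℕ
  /-- (ii-4) `p ∈ 𝔭_{c•w}` too (ED. 2; the dock՚s `hpw` at the block place; `c•w ∣ p` since `c(p) = p`). -/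
  hpCharConj : (pChar : 𝓞 F) ∈ ((IsCMField.complexConj F) • w).asIdeal
  /-- (R-1) `N(c•w) = p^{f_w}` (ED. 2: the dock՚s `hf` at the block place; `N(c•w) = N(w)`). -/
  hfDeg : Nat.card (𝓞 F ⧸ ((IsCMField.complexConj F) • w).asIdeal) = pChar ^ fDeg
  /-- (R-1) `κ̄(w)` has characteristic `p`. -/
  charP₀ : CharP (geomResidueField w) pChar
  /-- (ii-6) TWIST IDEALS `𝔞_γ` (data; (C2) ★ p846565 shape at a Frobenius). -/
  twistIdeal : (Fi ≃ₐ[F] Fi) → Ideal (𝓞 F)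
  /-- (ii-5′) TWIST NORMS `n_γ`. -/
  twistNorm : (Fi ≃ₐ[F] Fi) → ℕ
  /-- `(n_γ) = 𝔞_γ𝔞̄_γ`. -/
  twistNorm_spec : ∀ γ : Fi ≃ₐ[F] Fi,
    Ideal.span {((twistNorm γ : ℕ) : 𝓞 F)} = twistIdeal γ * (IsCMField.complexConj F) • twistIdeal γ
  /-- (f6) `𝔞_γ` prime to the level `N` (Defs ED. 2 field). -/
  twistIdeal_coprime : ∀ γ : Fi ≃ₐ[F] Fi, twistIdeal γ ⊔ Ideal.span {((N : ℕ) : 𝓞 F)} = ⊤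
  /-- (ii-6″) `𝔞_γ ≠ 0` — TOKEN-IDENTICAL to `ModuliDatum.twistIdeal_ne_bot` (Defs ED. 3 :933, LEAD «M-24»): class (A) for `stub_DATUM` (NOT derivable from the other
  fields — A-p03 (g30) ∕ desk census 22:55:19Z — hence carried across the interface; door (E): `𝔞_γ` is the ideal of an idele, never zero).
  [cite: Shimura1998, §13.1, Theorem 1 (pp. 97–99); §18.6 proof of Thm. 18.6, p. 127] -/
  twistIdeal_ne_bot : ∀ γ : Fi ≃ₐ[F] Fi, twistIdeal γ ≠ ⊥
  -- ===================== ED. 3 (closing-window field list of record, LEAD «M-39»∕(P-1) 00:06:48Z + Q-FROB-1 00:44:18Z (2); desk heir (g4) W2′ «fields first» 01:04:02Z): (P-1) the quasi-inverse of `λ` prime to `p`, (FROB) the two Frobenius readings of the twist data =====================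
  /-- (P-1) **THE POLARISATION IS QUASI-INVERTIBLE PRIME TO `p`**: `λ ≫ ν = [d]` for a homomorphism `ν : 𝒜^∨ → 𝒜` and `d` prime to `p = pChar` (door (E): the
  E-tuple՚s polarisation has type `δ`, the primes dividing `∏ δᵢ` go into `S_M`; ★ `Polarization.exists_quasiInverse` currency `pol.lam ≫ μ = A.mulN e`).  Consumer: the
  `w`-block Cartier-duality road of the D-line (`stub_LAYER`∕`stub_D6` through the W-dock՚s `hlam`: `λ` injective on `A[p^r]`).  `RGDInputsAt` only — no `ModuliDatum` twin
  (LEAD (P-1); GEN 00:07:55Z). [cite: MumfordAV1970, §7 Thm. 4 (p. 72)] [cite: Liu2021, Rem. C.13 (p. 112); Def. C.19 (pp. 116–117)] -/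
  polQuasiInv : ∃ (d : ℕ) (ν : dual.hat.X ⟶ univ.X), IsMonHom ν ∧ pChar.Coprime d ∧ pol.lam ≫ ν = univ.mulN d
  /-- (FROB-𝔞) **`𝔭_w` DIVIDES THE TWIST IDEAL OF A FROBENIUS-READING `γ`** (`𝔞_{γ_σ} = 𝔭_w^{d_w}𝔟_γ`, Shimura–Taniyama at `w`; binders = Defs `FrobReading₀.frobIdeal_spec`
  VERBATIM, conclusion = A-p03 (g30) `stub_WDIV` VERBATIM): door (E) reciprocity content (`γ_σ = rec(s)` with `s_w` a uniformiser, (C2) ★ p846565), paid by the P-line; consumed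
  by the D-line՚s `frob₀_of_inputs` as the projection `I.twistIdeal_frob` (`frobIdeal_spec := frobIdealOf_mul_eq ∘ I.twistIdeal_frob`). [cite: Shimura1998, §13.1 Thm. 1 (pp. 97–99); §18.6 (p. 127)] -/
  twistIdeal_frob : ∀ (σ : Field.absoluteGaloisGroup (w.adicCompletion F)), IsAbsArithFrob σ → ∀ γ : Fi ≃ₐ[F] Fi,
    ((AlgEquiv.restrictScalars F (Field.absoluteGaloisGroup.toAlgEquiv (w.adicCompletion F) σ) :
        AlgebraicClosure (w.adicCompletion F) ≃ₐ[F] AlgebraicClosure (w.adicCompletion F)) :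
        AlgebraicClosure (w.adicCompletion F) →ₐ[F] AlgebraicClosure (w.adicCompletion F)).comp e = e.comp (γ : Fi →ₐ[F] Fi) →
    w.asIdeal ∣ twistIdeal γ
  /-- (FROB-n) **`n_γ = p^{f_w}` FOR A FROBENIUS-READING `γ`** (`(n_γ) = 𝔞_γ𝔞̄_γ = (N w)`; binders = Defs `FrobReading₀.twistNorm_eq` VERBATIM, conclusion = A-p03 (g30)
  `stub_WNORM` VERBATIM): paid by the P-line with `twistIdeal_frob`; consumed by the D-line as `twistNorm_eq := I.twistNorm_frob`. [cite: Shimura1998, §13.1 Thm. 1 (pp. 97–99); §18.6 (p. 127)] -/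
  twistNorm_frob : ∀ (σ : Field.absoluteGaloisGroup (w.adicCompletion F)), IsAbsArithFrob σ → ∀ γ : Fi ≃ₐ[F] Fi,
    ((AlgEquiv.restrictScalars F (Field.absoluteGaloisGroup.toAlgEquiv (w.adicCompletion F) σ) :
        AlgebraicClosure (w.adicCompletion F) ≃ₐ[F] AlgebraicClosure (w.adicCompletion F)) :
        AlgebraicClosure (w.adicCompletion F) →ₐ[F] AlgebraicClosure (w.adicCompletion F)).comp e = e.comp (γ : Fi →ₐ[F] Fi) →
    twistNorm γ = pChar ^ fDeg
  -- ===================== ED. 4 (LEAD «M-57» rows of record, fields-first while the P-line is unwritten; GEN Q-MIX′ (B-1), LA3-plan «Q-ROOF-α» (π1)∕(π2-G), LA-ref1 box L3 #1): the banal values of the signature and the Frobenius pin of the twist ideal =====================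
  /-- (B-1) **THE SIGNATURE IS A SUM OF A CM TYPE AND ITS CONJUGATE OFF THE PAIR: `m τ + m (τ ∘ c) = 2`** (`n = 2`).  Door (E): `m = mOf ι₁ Φ` (E-line :136) takes the values
  `1` on `{ι₁, ῑ₁}`, `0` on `Φ`, `2` on `Φᶜ` — BY DEFINITION; the D-line cannot derive it from `kottwitzΩ` + `m_count` (GEN Q-MIX′). [cite: RapoportSmithlingZhang2020Diagonal, §3.2 (3.8) p. 11, Rem. 3.6 (3.14) p. 13]
  [cite: Kottwitz1992, §5 p. 390] -/
  m_pair : ∀ τ : F →+* AlgebraicClosure (w.adicCompletion F),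
    m τ + m (τ.comp ((IsCMField.complexConj F : F ≃ₐ[↥(maximalRealSubfield F)] F) : F →+* F)) = 2
  /-- (B-1) **THE BANAL VALUES: `m τ ∈ {0, 2}` at every embedding inducing neither `w` nor `c•w`** (the hermitian space is DEFINITE at the other real places; door (E) by
  definition of `mOf`).  Without it a banal pair `(1,1)` (an `ét × mult` block, where `Ker F_q` is no ideal torsion) inhabits the interface and (rL) of `Roof₀` is false (GEN
  Q-MIX′; LA-ref1 box L3 #1).  With it the banal places are étale (`k_u = 0`), multiplicative (`k_u = d_u`) or MIXED (`0 < k_u < d_u`; LEAD «M-56»: honest inhabitants, no guard).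
  [cite: RapoportSmithlingZhang2020Diagonal, §3.2 (3.8) p. 11, Rem. 3.6 (3.14) p. 13] [cite: Kottwitz1992, §5 p. 390] -/
  m_banal : ∀ τ : F →+* AlgebraicClosure (w.adicCompletion F),
    RingHom.ker ((IsLocalRing.residue ↥(closureValuationSubring (w.adicCompletion F))).comp (τR τ)) ≠ (w.asIdeal : Ideal (𝓞 F)) →
    RingHom.ker ((IsLocalRing.residue ↥(closureValuationSubring (w.adicCompletion F))).comp (τR τ)) ≠
      (((IsCMField.complexConj F) • w).asIdeal : Ideal (𝓞 F)) →
    m τ = 0 ∨ m τ = 2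
  /-- (π1) **THE TWIST IDEAL OF A FROBENIUS READING IS PRIME TO `𝔭_{c•w}`** («on the `c•w`-block the Frobenius co-ideal `𝔠 = 𝔞_γ𝔭_w⁻¹` is a unit» — the (rL) block reading
  of Defs `Roof₀`; forced by an order count on the dock, LA3-plan memo 819cf5b7 §1; NOT implied by `twistNorm_spec` + `twistNorm_frob`, which only give the LOCAL norm
  equation `v_u(𝔞) + v_{c•u}(𝔞) = e_u f_w` and leave the `U_N`-orbit free).  Binders VERBATIM `FrobReading₀`. [cite: Shimura1998, §13.1 Thm. 1 (pp. 97–99); §18.6 (p. 127)] -/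
  twistIdeal_coprime_conj : ∀ (σ : Field.absoluteGaloisGroup (w.adicCompletion F)), IsAbsArithFrob σ → ∀ γ : Fi ≃ₐ[F] Fi,
    ((AlgEquiv.restrictScalars F (Field.absoluteGaloisGroup.toAlgEquiv (w.adicCompletion F) σ) :
        AlgebraicClosure (w.adicCompletion F) ≃ₐ[F] AlgebraicClosure (w.adicCompletion F)) :
        AlgebraicClosure (w.adicCompletion F) →ₐ[F] AlgebraicClosure (w.adicCompletion F)).comp e = e.comp (γ : Fi →ₐ[F] Fi) →
    twistIdeal γ ⊔ (((IsCMField.complexConj F) • w).asIdeal : Ideal (𝓞 F)) = ⊤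
  /-- (π2-G) **THE BANAL-BLOCK FROBENIUS-KERNEL LAW FOR THE TWIST IDEAL OF A FROBENIUS READING** (`FrobKernelBanal₀ … (twistIdeal γ)`: at every `red₀ y`, on `u`-primary
  `T`-points for `u ∣ p` off `{w, c•w}`, `Ker F_q = A[𝔞_γ]`) — the banal third of (rL), moved to the twist side where print pays it (Shimura–Taniyama for the frame CM object behind
  door (E), [Shimura1998] §13.1 Thm. 1, §18.6; LEAD «M-56» (ii): uniform over étale ∕ multiplicative ∕ mixed banal blocks).  Binders VERBATIM `FrobReading₀`; the `ExpChar`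
  instance opened as in Defs `ModuliDatum.frob₀`.  Consumer: `stub_ROOF0`՚s `_hpin` (A-p03 v3∕v4 ∕ LA3-plan v3-pin). [cite: Shimura1998, §13.1 Thm. 1 (pp. 97–99); §18.6 (p. 127)]
  [cite: Liu2021, Prop. D.8 (3) p. 135, pp. 136–138] [cite: Kottwitz1992, §5 (p. 391)] -/
  frobKernel_banal : ∀ (σ : Field.absoluteGaloisGroup (w.adicCompletion F)), IsAbsArithFrob σ → ∀ γ : Fi ≃ₐ[F] Fi,
    ((AlgEquiv.restrictScalars F (Field.absoluteGaloisGroup.toAlgEquiv (w.adicCompletion F) σ) :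
        AlgebraicClosure (w.adicCompletion F) ≃ₐ[F] AlgebraicClosure (w.adicCompletion F)) :
        AlgebraicClosure (w.adicCompletion F) →ₐ[F] AlgebraicClosure (w.adicCompletion F)).comp e = e.comp (γ : Fi →ₐ[F] Fi) →
    haveI : ExpChar (geomResidueField w) pChar := (haveI : CharP (geomResidueField w) pChar := charP₀; ExpChar.prime hpChar.1);
    FrobKernelBanal₀ S Kc 𝓜 w h𝓨 e univ act pChar fDeg (twistIdeal γ)
  /-- (B-2) **THE FRAME IS UNMIXED: `m` is CONSTANT on the embeddings inducing one banal place** (LEAD «M-57b»∕«M-57c» row 39): two embeddings with the same kernel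
  (= inducing the same place `u ∉ {w, c•w}`) carry the same `m` — the frame regime under which door (E) pays row 38 elementarily (the `u`-block of `Lie` is `0` or everything,
  étale ★ `TorsionBlockEtaleOfLieSignature` ∕ multiplicative via `polQuasiInv` + ★ `CartierDualBlockDuality`); the P-line CHOOSES its frame `Φ` adapted at `c•w` and oriented
  wholesale on each banal pair `{u, c•u}`, so `mOf ι₁ Φ` satisfies it by definition.  Mixed frames remain honest inhabitants of the ED. 3 interface (LEAD «M-56» (i)); this row
  narrows `RGDInputsAt`, NOT the letter. [cite: RapoportSmithlingZhang2020Diagonal, §3.2 (3.8) p. 11, §4.1 p. 17] [cite: Kottwitz1992, §5 p. 390] -/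
  m_unmixed : ∀ τ τ' : F →+* AlgebraicClosure (w.adicCompletion F),
    RingHom.ker ((IsLocalRing.residue ↥(closureValuationSubring (w.adicCompletion F))).comp (τR τ)) =
      RingHom.ker ((IsLocalRing.residue ↥(closureValuationSubring (w.adicCompletion F))).comp (τR τ')) →
    RingHom.ker ((IsLocalRing.residue ↥(closureValuationSubring (w.adicCompletion F))).comp (τR τ)) ≠ (w.asIdeal : Ideal (𝓞 F)) →
    RingHom.ker ((IsLocalRing.residue ↥(closureValuationSubring (w.adicCompletion F))).comp (τR τ)) ≠
      (((IsCMField.complexConj F) • w).asIdeal : Ideal (𝓞 F)) →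
    m τ = m τ'
  /-- (K-law) **THE GENERIC SERRE COVERS BETWEEN SHEETS, WITH THEIR KERNEL LAW** (LEAD «M-57c» row 40; A-p03 (g30) Q-COV-KER): for every sheet `e′`, every `γ` and every record
  point `y`, `CoverKerΩ … e′ … (e′ ∘ γ) (𝔞_γ) (n_γ) y` — the (L5) cover `coverΩ` (same binders, kept) PLUS (t1′) `Ker c = A[𝔞_γ]` on all `T`-points.  Door (E): ★ α2a on the
  Serre translate (all `T`).  Consumer: `stub_COVER0` road A (`stub_COVKER :=` the projection `I.coverKerΩ e′ γ y`). [cite: Shimura1998, §13.1, Theorem 1; §18.6]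
  [cite: RapoportSmithlingZhang2020Diagonal, §3.2 p. 11, §4.3 p. 20] -/
  coverKerΩ : ∀ (e' : Fi →ₐ[F] AlgebraicClosure (w.adicCompletion F)) (γ : Fi ≃ₐ[F] Fi)
    (y : AlgPoints (S.M.obj Kc) (AlgebraicClosure (w.adicCompletion F))),
    CoverKerΩ S Kc 𝓜 w e' univ act dual pol lvl (e'.comp (γ : Fi →ₐ[F] Fi)) (twistIdeal γ) (twistNorm γ) y
  -- ===================== ED. 2 (F0P5a-ref1 (g7) n2 + LEAD M-26-pre): THE LAWS DOOR (E) SUPPLIES AND `stub_DATUM` CONSUMES — (L1′) special injectivity at `w`, (L1) generic injectivity per sheet, (L4) Hecke roofs, (L5) Serre covers =====================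
  /-- (L1′) **SPECIAL FINE-MODULI INJECTIVITY ON THE SHEET `e`, AT THIS `w`** — TOKEN-IDENTICAL to `ModuliDatum.inj₀` (Defs ED. 3 :913–:915): class (A) for
  `stub_DATUM` (`inj₀ := I.inj₀`).  It is an AT-`w` LAW the interface must CARRY (LEAD «M-26-pre (L1′)» 22:36:20Z; F0P6-ref1 (g3) o-14; P6c (g4), F0P5a-ref1 (g7),
  desk heir (g3) concur): the only bridge from the generic per-sheet `injΩ` to the special fibre is the COFINITE passage (SP3-a2 `Isom` of finite type + ★ SP3-b
  p846927 constructible-empty-generic-fibre ⇒ empty over an open of `Spec 𝒪_{Fᵢ}[1∕M]` + ★ INT-RES `reductionAt_point_ext`∕`specialSheet_eq_iff`), which QUANTIFIES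
  OVER `w` and outputs an enlargement `S_M ⊇ Σ_Isom` — so it is paid inside `stub_PEL` (where `S_M` is chosen), never inside `stub_DATUM` (one `w`, no `S_M`;
  P6c՚s nodal-cubic degeneration is the counter-model to «generic injectivity descends to the same prime»). [cite: MumfordFogartyKirwan1994, Ch. 7 §3 Theorem 7.9 (p. 139)]
  [cite: RapoportSmithlingZhang2020Diagonal, §4.1 Thm. 4.1 p. 17] -/
  inj₀ : ∀ y₁ y₂ : AlgPoints (S.M.obj Kc) (AlgebraicClosure (w.adicCompletion F)),
    tupleIsoAt (spPt 𝓜 w (red₀Of S Kc 𝓜 w h𝓨 e y₁)) (spPt 𝓜 w (red₀Of S Kc 𝓜 w h𝓨 e y₂)) univ act dual pol lvl →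
    red₀Of S Kc 𝓜 w h𝓨 e y₁ = red₀Of S Kc 𝓜 w h𝓨 e y₂
  /-- (L1) **GENERIC FINE-MODULI INJECTIVITY, PER SHEET**: two record points read on the SAME sheet `e′` whose generic tuples `(A, ι, λ, lvl)` are isomorphic
  (★ `tupleIsoAt` at the generic base points `genPt … e′ yᵢ`; EXACT level `N`, EXACT `λ`) are EQUAL — the law `inj₀` (SP3: constructibility + this at
  the generic fibre) threads through; door (E): `ε` injective on the slice at GEN՚s principal `Kc` (tower separation ★ `UnitaryCurve.eq_of_forall_siegelPointMap_eq`
  + Deligne stationarity) composed with Siegel `classify`.  Sheet-wise, NOT global (Defs :885 «INJ ACROSS SHEETS» is false). [cite: MumfordFogartyKirwan1994, Ch. 7 §3 Theorem 7.9 (p. 139)] -/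
  injΩ : ∀ (e' : Fi →ₐ[F] AlgebraicClosure (w.adicCompletion F)) (y₁ y₂ : AlgPoints (S.M.obj Kc) (AlgebraicClosure (w.adicCompletion F))),
    tupleIsoAt (genPt S Kc 𝓜 w e' y₁) (genPt S Kc 𝓜 w e' y₂) univ act dual pol lvl → y₁ = y₂
  /-- (L4) **THE GENERIC HECKE ROOFS** (the (U4) reading «Hecke translate at `w` = isogeny roof», [HarrisTaylorAMS2001] §III.4; E-line ED. 2 marking reading +
  ★ `RecordHeckePresentation.hecke_of_hecke_at_level`): for every sheet `e′`, every presentation `(N′ ≤ Kc, rc₁, rc₂)` of the two Hecke operators at `w` (the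
  binders of `ModuliDatum.hecke` VERBATIM) and every `x′ ∈ M⋆_{N′}(Ω)` over `y := u x′`: a map `β ↦ H_β` from the cosets of `Kc t₁ Kc ∕ Kc` to subgroups of
  `A_y(Ω)` which is a BIJECTION onto the `𝒪_F`-stable subgroups of order `q = p^f` killed by `𝔭_{c•w}` (★ `IsIdealTorsionΩ`), such that each translate
  `T_{rc₁ β} x′` is the ROOF NEIGHBOUR of `y` through a kernel `K_β` meeting the `𝔭_{c•w}`-torsion in `H_β` (★ `RoofΩ`, cover ideal `𝔭_w`), and the translate
  `T_{rc₂} x′` is the roof neighbour through the whole `𝔭_{c•w}`-torsion (the central translate `⟨ϖ⟩`). [cite: HarrisTaylorAMS2001, §III.4, pp. 108–110]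
  [cite: RapoportSmithlingZhang2020Diagonal, §4.1 p. 17, §4.3 (4.23) p. 21] [cite: Liu2021, Lemma C.18 p. 115, Prop. D.8 p. 135] -/
  heckeRoofΩ : HeckeRoofsΩ S hU7ₛ hJ hJu Kc 𝓜 w hw univ act dual pol lvl pChar fDeg
  /-- (L5) **THE GENERIC SERRE COVERS BETWEEN SHEETS** (the twist reading; [Shimura1998] §18.6 Main Theorem 1 on the frame point + (C2) ★ p846565 for the
  ideal shape): for every sheet `e′`, every `γ` and every record point `y`, `𝒯(ℓ_{e′} y) ≅ 𝒯(ℓ_{e′∘γ} y) ⊗_{𝒪_F} 𝔞_γ` EXACTLY with norm `n_γ` (★ `CoverΩ`). -/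
  coverΩ : ∀ (e' : Fi →ₐ[F] AlgebraicClosure (w.adicCompletion F)) (γ : Fi ≃ₐ[F] Fi)
    (y : AlgPoints (S.M.obj Kc) (AlgebraicClosure (w.adicCompletion F))),
    CoverΩ S Kc 𝓜 w e' univ act dual pol lvl (e'.comp (γ : Fi →ₐ[F] Fi)) (twistIdeal γ) (twistNorm γ) y

/-! ### §2 The two stubs -/

/-- **LETTER `RecordPELInputsCofinal`** — `RecordModuliDatumCofinal` TOKEN FOR TOKEN with `Nonempty (ModuliDatum …)` replaced by `Nonempty (RGDInputsAt …)`: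
GEN chooses `Fᵢ Kc G φ 𝓜 S_M` once, and at every good split `w` delivers hyperspecial-`Kc`, `hdisj` and the LOCALISED PEL TUPLE WITH ITS LAWS.  NOT asserted.
(print: RapoportSmithlingZhang2020Diagonal, §4.1 Thm. 4.1 p. 17) (print: Kottwitz1992, §5 pp. 389–391) -/
def RecordPELInputsCofinal : Prop :=
  ∀ (F : Type) [Field F] [NumberField F] [IsCMField F] [IsGalois ℚ F] (ι₁ : F →+* ℂ)
    (Jstar : Matrix (Fin 2) (Fin 2) F)
    (K₀ : C5.OpenCompactSubgroup ↥(finAdelic ↥(maximalRealSubfield F) F (IsCMField.complexConj F) 2 Jstar))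
    (S : RecordSystemGS F Jstar ι₁ K₀) (hU7ₛ : S.HeckeTranslateDefinedOver)
    (hJ : (Jstar.map (IsCMField.complexConj F))ᵀ = Jstar) (hJu : IsUnit Jstar) (K : C5.SmallLevel K₀),
    ∃ (Fi : Type) (_ : Field Fi) (_ : Algebra F Fi) (_ : FiniteDimensional F Fi) (_ : IsGalois F Fi)
      (Kc : C5.SmallLevel K₀) (_hKcK : Kc ≤ K) (_hn : ∀ k ∈ K.1.1, C5.HeckeLE k Kc Kc)
      (G : Type) (_ : Group G) (_ : Finite G) (φ : ↥K.1.1 →* G) (_hφ : Function.Surjective φ)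
      (_hφker : φ.ker = (Kc.1.1 : Subgroup ↥(finAdelic ↥(maximalRealSubfield F) F (IsCMField.complexConj F) 2 Jstar)).subgroupOf K.1.1)
      (𝓜 : IntegralModel (𝓞 F) F ((thickening F Fi).obj (S.M.obj Kc)))
      (_ : QuasiCompact 𝓜.total.hom) (_ : QuasiSeparated 𝓜.total.hom) (_ : LocallyOfFinitePresentation 𝓜.total.hom)
      (_ : Flat 𝓜.total.hom) (_ : IsSeparated 𝓜.total.hom)
      (S_M : Set (HeightOneSpectrum (𝓞 F))), S_M.Finite ∧
      ∀ w : HeightOneSpectrum (𝓞 F), w ∉ S_M → ∀ hw : (IsCMField.complexConj F) • w ≠ w,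
        (UnitaryGroup.isUnit_placeForm Jstar hJu w).unit ∈ glInt 2 (w.adicCompletion F) →
          UnitaryGroup.IsHyperspecialAt ↥(maximalRealSubfield F) F (IsCMField.complexConj F) 2 Jstar K.1.1
            (w.under (𝓞 ↥(maximalRealSubfield F))) →
          UnitaryGroup.IsHyperspecialAt ↥(maximalRealSubfield F) F (IsCMField.complexConj F) 2 Jstar Kc.1.1
              (w.under (𝓞 ↥(maximalRealSubfield F))) ∧
          ∀ (h𝓨 : (𝓜.localise w).IsSmoothProper 1)
            (θ : ActionOver (𝓜.localise w).total.hom ((Fi ≃ₐ[F] Fi) × G))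
            (_hθ : ∀ γ : Fi ≃ₐ[F] Fi,
               (genericFibre (HeightOneSpectrum.valuationSubringAtPrime F w) F).map
                     (Over.isoMk (θ.aut (γ, 1)) (θ.aut_comp (γ, 1))).hom ≫ (𝓜.localise w).genericIso'.hom
                 = (𝓜.localise w).genericIso'.hom ≫
                     (Over.isoMk ((thickeningGalAction (L := Fi) (S.M.obj Kc)).aut γ)
                       ((thickeningGalAction (L := Fi) (S.M.obj Kc)).aut_comp γ)).hom)
            (e : Fi →ₐ[F] AlgebraicClosure (w.adicCompletion F)),
            haveI : AlgebraicGeometry.IsProper (𝓜.localise w).total.hom := h𝓨.2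
            (∀ (β : Fi ≃ₐ[F] Fi) (P Q : AlgPoints (S.M.obj Kc) (AlgebraicClosure (w.adicCompletion F))),
                (𝓜.localise w).geomReductionMap (thickeningLift e (S.M.obj Kc) P) =
                  AlgPoints.map ((specialFibreFunctor w).map (Over.isoMk (θ.aut (β, 1)) (θ.aut_comp (β, 1))).hom :
                      (𝓜.localise w).reductionAt ⟶ (𝓜.localise w).reductionAt)
                    ((𝓜.localise w).geomReductionMap (thickeningLift e (S.M.obj Kc) Q)) → β = 1) ∧
              Nonempty (RGDInputsAt F ι₁ Jstar K₀ S hU7ₛ hJ hJu Fi Kc G 𝓜 w hw h𝓨 θ e)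

/-! **SOCKET `stub_PEL : RecordPELInputsCofinal` — NOT IN THE ★ RE-HOME; KEPT IN THE `Lines/` HUB** (`Lines/F0_P6a_RGDAssembly.lean` ED. 6 = `import` of this ★ module +
the two sockets `stub_PEL`∕`stub_DATUM` + the junction `rgd_of_parts`, SAME namespace, so every FQN and the books՚ socket census are unchanged).  A `Theorems/` file carries no
`sorry`; the socket is closed BY NAME downstream (P-LINE `F0P6aPELInputs.pel_of_inputs …` read by MAIN `F0_P6a_ModuliDatum` ED. 10).  K5-H1 «hub twin minus sockets»
(LA7-plan (g7) RE-HOME TABLE v1.7; LA2-plan (g5) PLAN «L2 cone RE-HOME» v1 §0 (H1)). -/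

end Summit.HodgeConjecture.HodgeConjecture.Cruxes.HLiu418.F0P6aRGDAssembly
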